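import Literature.MathematicalPhysics.QuantumFieldTheory.Balaban1983to89.T4Cov2156Rate
import Literature.MathematicalPhysics.QuantumFieldTheory.Balaban1983to89.QGQInverse

/-!
# Route «BalabanUVNodes», cluster K4 «SpineRates» — node N15 = NE2, UNIT-LATTICE LAYER WITH THE BACKGROUND LIVE, file U-A (dag-n15-a g16, LOCATED-1):
# THE PERTURBED (2.156) COVARIANCE `C(C*(Δ_k + P)C)⁻¹C*` ON THE UNIT TORUS — positivity, uniform decay and King's (4.38)-shaped η-rate, GENERIC in a
# small exponentially decaying symmetric perturbation `P` of THE (1.66) matrix `Δ_k`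

Cell `pub-ymgap`, seat `pub-ymgap-dag-n15-a` (-a KNIT-BY-NAME seat of node N15; HUMAN RULING D-0062; chair R424 venue), generation 16, file U-A of the LOCATED-1
programme (INBOX l.22312; dag-lead DEDUP-330 (9), dag-n15-c g9 NO-THANKS l.22608).  `bears_on: R4∕N15 · K3⁷ SpineGivenEndpointR13SepCoPH (stmt-QuantumFields-20544)`.
Filed `--kind proof --supports stmt-QuantumFields-20544 --as helper` — COUNT-NEUTRAL.  THEOREMS ONLY plus ONE numeric `def` (the smallness threshold
`epsCov`).  Imports BY NAME pub-balaban's `T4Cov2156Rate` (the resolvent identity `redCov_sub` ∕ King's (4.41) bound `redCov_rate`, `kernelRate166`,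
`bondSum_le`, `bondDist_nonneg∕_triangle`, `subReduction_cov_eq`; through it `B6Cov2156Torus`: THE matrix `deltaPol M n` of the (1.66) form, the explicit
elimination matrix `elimT` of p.250, (2.153) on the torus `lowerOnConstrainedT_of_represents`, the generic p.250 decay engine `bond250_torusT`,
`B5Kernel166Decay.kernelDecay166`) and `QGQInverse` (the finite Schur test `form_abs_le_of_schur`); nothing in the tree is modified.

WHY (the unit half of LOCATED-1).  Part 76 read the node's third layer at `U ≡ 1` as Bałaban's fluctuation covariance `C^{(k)} = C(C*Δ_kC)⁻¹C*` ([B6]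
(2.156)) through `T4Cov2156Rate.cov2156_rate_torus_king`; ref-B's standing finding «(ii) site ∕ unit layers U-blind» asks for a third layer that READS the
background.  The model of files U-B…U-D dresses THE (1.66) form by the operator layer's own background-dressed propagator: `Δ_k(U) = Δ_k + P(U)` with
`P(U)` symmetric, exponentially decaying and (3.35)-small.  THIS FILE is the part of the argument that does not see where `P` comes from: for ANY symmetric
`P` with `|P(b,b′)| ≤ ε·e^{−δ_Pρ_M(b₋,b′₋)}` and `ε ≤ ε₀(d, L, δ_P)` —
* §1 (2.153)∕(2.157) SURVIVE: `lowerOnConstrainedT_add` (a form bound `|⟨B,PB⟩| ≤ ρ‖B‖²` costs `ρ` of the constant), `form_abs_le_of_decay` (Schur: `ρ = ε·d·K_d(δ_P)`),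
  `lowerOnConstrainedT_deltaPol_add` (constant `γ′₀∕2`, `γ′₀ = gamma2153 d L`), `isUnit_sandwich_torus_add` (`C*(Δ_k+P)C` invertible) — NO Neumann series in a weight:
  the inverse exists by the PRINTED positivity (2.153) p.249 of `Δ_k` on the constrained subspace, for every perturbation below the threshold;
* §2 ★ `cov2156_decay_torus_add`: ONE `(c, δ)` after `(d, L, δ_P)` with `|C(C*(Δ_k+P)C)⁻¹C*(b,b′)| ≤ c·e^{−δρ_M(b₋,b′₋)}` for EVERY torus (`L ∣ M_i`), level
  `n ≥ 1` and admissible `P` (`bond250_torusT` at `γ′₀∕2`, entry decay `c₀ + ε₀` at rate `min(δ₀, δ_P)`);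
* §3 ★★ `cov2156_rate_torus_add`: ONE `(C′, δ′)` with `|C^{(n₂)}_{P₂}(b,b′) − C^{(n₁)}_{P₁}(b,b′)| ≤ C′·(n₁⁻¹ + τ)·e^{−δ′ρ_M(b₋,b′₋)}` for all levels `n₂ = Rn₁`,
  admissible `P₁, P₂` and any letter `|P₂ − P₁|(b,b′) ≤ τ·e^{−δ_Pρ}` (`redCov_rate`: both endpoint decays from §2, middle factor `kernelRate166 + τ`); ★★
  `cov2156_rate_torus_add_king`: `n₁ = L^k`, `n₂ = L^{k+m}` ⟹ `≤ C′·((L^k)⁻¹ + τ)·e^{−δ′ρ}` — King's Lemma 4.5 (4.38) SHAPE for the perturbed covariance; at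
  `P₁ = P₂ = 0` it is `T4Cov2156Rate.cov2156_rate_torus_king` again (`cov2156_rate_torus_add_zero`).

HONEST FRAMING.  Finite-dimensional linear algebra on the unit torus, count-neutral; NOTHING here is printed as such ([B9] Thm 3.15 (3.187) p.432 is the
general-`U` statement whose proof is not displayed, G-B9-10; (2.157)'s `γ′₀` at general `U` is asserted not proved, G-B9-09 — this file does NOT touch
either: it perturbs the `U ≡ 1` matrix by an abstract small `P`); GENUINE objects: the (1.66) matrix, the p.250 elimination matrix, (2.153) on the torus,
the Sect.-5-of-[B4] engine — all pub-balaban theorems consumed by name; constants crude and ours.  N15 NOT discharged (typed 28∕28 · discharged 5∕27 of record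
unchanged); one finite unit torus at a time — NOT ℝ⁴, NOT infinite volume, NOT OS, NOT a mass gap, NOT Clay.  Restate-immune (no Theses import).
-/

set_option autoImplicit false

noncomputable section

open Finset Matrix

namespace Summit.QuantumFields.YangMills.BalabanUVNodes.N15.UnitLayerBg

open Literature.MathematicalPhysics.QuantumFieldTheory.Balaban1983to89
open Literature.MathematicalPhysics.QuantumFieldTheory.King1986 (triple_decay_bound exp_decay_mono)
open Literature.MathematicalPhysics.QuantumFieldTheory.Balaban1983to89.B6Lemma24Torus (pbox)
open Literature.MathematicalPhysics.QuantumFieldTheory.Balaban1983to89.B6BondEliminationTorus (pdist)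
open Literature.MathematicalPhysics.QuantumFieldTheory.Balaban1983to89.B6BondElimination (isUnit_det_of_lower)
open Literature.MathematicalPhysics.QuantumFieldTheory.Balaban1983to89.B6Cov2156Torus (freeT elimT deltaPol deltaPol_isSymm represents_deltaPol
  bondReductionT LowerOnConstrainedT lowerOnConstrainedT_of_represents gamma2153 gamma2153_pos one_le_M bond250_torusT q1_elimT_mulVec elimT_mulVec_tree
  elimT_iso)
open Literature.MathematicalPhysics.QuantumFieldTheory.Balaban1983to89.B5Kernel166Decay (kernelDecay166)
open Literature.MathematicalPhysics.QuantumFieldTheory.Balaban1983to89.T4Cov2156Rate (redCov redCov_sub redCov_rate subReduction_cov_eq kernelRate166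
  bondDist_nonneg bondDist_triangle bondSum_le)
open Literature.MathematicalPhysics.QuantumFieldTheory.Balaban1983to89.QGQInverse (form_abs_le_of_schur)
open Literature.MathematicalPhysics.QuantumFieldTheory.Balaban1983to89.B4Sect5Proof (latticeConst latticeConst_nonneg)

variable {d : ℕ} {L : ℕ}

/-! ## §1 (2.153) and (2.157) survive a small symmetric perturbation — no weight window -/

section Positivity

variable {M : Fin d → ℕ} [∀ μ, NeZero (M μ)]

/-- **(2.153) SURVIVES A FORM-SMALL PERTURBATION**: if `Δ ≥ γ` on the constrained subspace of the torus (`LowerOnConstrainedT`) and `|⟨B, PB⟩| ≤ ρ‖B‖²` for all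
`B`, then `Δ + P ≥ γ − ρ` on the same subspace. [cite: Balaban1984PropagatorsII, (2.153) p.249 (shape)] [folklore] -/
theorem lowerOnConstrainedT_add {Δ P : Matrix (B4.Idx (pbox M) d) (B4.Idx (pbox M) d) ℝ} {γ ρ : ℝ} (hl : LowerOnConstrainedT L M Δ γ)
    (hP : ∀ B : B4.Idx (pbox M) d → ℝ, |∑ p, B p * (P *ᵥ B) p| ≤ ρ * ∑ p, B p ^ 2) :
    LowerOnConstrainedT L M (Δ + P) (γ - ρ) := by
  intro B hQ hT
  have h1 := hl B hQ hT
  have h2 := hP B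
  have hsplit : ∑ p, B p * ((Δ + P) *ᵥ B) p = ∑ p, B p * (Δ *ᵥ B) p + ∑ p, B p * (P *ᵥ B) p := by
    rw [Matrix.add_mulVec, ← Finset.sum_add_distrib]
    exact Finset.sum_congr rfl fun p _ => by rw [Pi.add_apply, mul_add]
  rw [hsplit, sub_mul]
  have h3 : -(ρ * ∑ p, B p ^ 2) ≤ ∑ p, B p * (P *ᵥ B) p := (abs_le.mp h2).1
  linarith

omit [∀ μ, NeZero (M μ)] in
/-- **THE SCHUR TEST FOR A DECAYING KERNEL**: a symmetric `P` with `|P(b,b′)| ≤ ε·e^{−δ_Pρ_M(b₋,b′₋)}` (`ε ≥ 0`, `δ_P > 0`) has `|⟨B, PB⟩| ≤ ε·(d·K_d(δ_P))·‖B‖²`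
(row and column sums `≤ ε·d·K_d(δ_P)` by King's volume-independent sums `bondSum_le`; `QGQInverse.form_abs_le_of_schur`). [folklore] -/
theorem form_abs_le_of_decay (hM1 : ∀ i, 1 ≤ M i) {P : Matrix (B4.Idx (pbox M) d) (B4.Idx (pbox M) d) ℝ} (hPs : P.IsSymm) {ε δP : ℝ}
    (hε : 0 ≤ ε) (hδP : 0 < δP)
    (hP : ∀ p q : B4.Idx (pbox M) d, |P p q| ≤ ε * Real.exp (-(δP * pdist M hM1 (p.1 : Fin d → ℤ) (q.1 : Fin d → ℤ))))
    (B : B4.Idx (pbox M) d → ℝ) :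
    |∑ p, B p * (P *ᵥ B) p| ≤ ε * ((d : ℝ) * latticeConst d δP) * ∑ p, B p ^ 2 := by
  have hK : 0 ≤ (d : ℝ) * latticeConst d δP := mul_nonneg (Nat.cast_nonneg _) (latticeConst_nonneg d hδP.le)
  have hrow : ∀ p, ∑ q, |P p q| ≤ ε * ((d : ℝ) * latticeConst d δP) := fun p => by
    have h1 : ∑ q : B4.Idx (pbox M) d, |P p q| ≤ ∑ q : B4.Idx (pbox M) d, ε * Real.exp (-(δP * pdist M hM1 (p.1 : Fin d → ℤ) (q.1 : Fin d → ℤ))) :=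
      Finset.sum_le_sum fun q _ => hP p q
    rw [← Finset.mul_sum] at h1
    exact h1.trans (mul_le_mul_of_nonneg_left (bondSum_le hM1 hδP p) hε)
  have hcol : ∀ q, ∑ p, |P p q| ≤ ε * ((d : ℝ) * latticeConst d δP) := fun q => by
    have e : ∀ p, P p q = P q p := fun p => by rw [← hPs.apply q p]
    simp_rw [e]
    exact hrow q
  have h := form_abs_le_of_schur P (ρ := ε * ((d : ℝ) * latticeConst d δP)) (mul_nonneg hε hK) (le_of_eq (pow_two _).symm) hrow hcol B
  have e1 : B ⬝ᵥ (P *ᵥ B) = ∑ p, B p * (P *ᵥ B) p := by simp only [dotProduct]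
  have e2 : B ⬝ᵥ B = ∑ p, B p ^ 2 := by simp only [dotProduct, pow_two]
  rw [e1, e2] at h
  exact h

variable (d L) in
/-- THE SMALLNESS THRESHOLD of the perturbation letter: `ε₀(d, L, δ_P) := γ′₀ ∕ (2·(d·K_d(δ_P) + 1))`, `γ′₀ = gamma2153 d L` — an entry letter `ε ≤ ε₀` costs at most
`γ′₀∕2` of (2.153)'s constant. [cite: Balaban1984PropagatorsII, (2.157) p.250 (shape)] -/
def epsCov (δP : ℝ) : ℝ := gamma2153 d L / (2 * ((d : ℝ) * latticeConst d δP + 1))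

omit [∀ μ, NeZero (M μ)] in
/-- `ε₀ > 0` (`d, L ≥ 1`, `δ_P > 0`). [folklore] -/
theorem epsCov_pos (hd : 1 ≤ d) (hL : 1 ≤ L) {δP : ℝ} (hδP : 0 < δP) : 0 < epsCov d L δP := by
  unfold epsCov
  have hK : 0 ≤ (d : ℝ) * latticeConst d δP := mul_nonneg (Nat.cast_nonneg _) (latticeConst_nonneg d hδP.le)
  exact div_pos (gamma2153_pos hd hL) (by positivity)

omit [∀ μ, NeZero (M μ)] in
/-- the bookkeeping of the threshold: `ε ≤ ε₀ ⟹ ε·(d·K_d(δ_P)) ≤ γ′₀∕2`. [folklore] -/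
theorem eps_mul_le_half_gamma (hd : 1 ≤ d) (hL : 1 ≤ L) {δP ε : ℝ} (hδP : 0 < δP) (hε : 0 ≤ ε) (hε₀ : ε ≤ epsCov d L δP) :
    ε * ((d : ℝ) * latticeConst d δP) ≤ gamma2153 d L / 2 := by
  have hK : 0 ≤ (d : ℝ) * latticeConst d δP := mul_nonneg (Nat.cast_nonneg _) (latticeConst_nonneg d hδP.le)
  have hγ := gamma2153_pos hd hL
  calc ε * ((d : ℝ) * latticeConst d δP) ≤ epsCov d L δP * ((d : ℝ) * latticeConst d δP + 1) :=
        mul_le_mul hε₀ (by linarith) hK (le_trans hε hε₀)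
    _ = gamma2153 d L / 2 := by
        unfold epsCov
        field_simp

/-- **(2.153) FOR THE PERTURBED (1.66) MATRIX**: for every torus (`L ∣ M_i`), level `n ≥ 1` and symmetric `P` with `|P(b,b′)| ≤ ε·e^{−δ_Pρ}`, `ε ≤ ε₀(d,L,δ_P)`:
`Δ_k + P ≥ γ′₀∕2` on the constrained subspace `{QB = 0, B = 0 on tree bonds}` — the PRINTED positivity (2.153) of `Δ_k = deltaPol M n`
(`lowerOnConstrainedT_of_represents`, pub-balaban) minus the Schur bound. [cite: Balaban1984PropagatorsII, (2.153) p.249, (2.157) p.250 (shapes)] [folklore] -/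
theorem lowerOnConstrainedT_deltaPol_add (hd : 2 ≤ d) (hL : 1 ≤ L) (hLM : ∀ i, L ∣ M i) {n : ℕ} (hn : 1 ≤ n)
    {P : Matrix (B4.Idx (pbox M) d) (B4.Idx (pbox M) d) ℝ} (hPs : P.IsSymm) {ε δP : ℝ} (hε : 0 ≤ ε) (hδP : 0 < δP) (hε₀ : ε ≤ epsCov d L δP)
    (hP : ∀ p q : B4.Idx (pbox M) d, |P p q| ≤ ε * Real.exp (-(δP * pdist M (one_le_M M) (p.1 : Fin d → ℤ) (q.1 : Fin d → ℤ)))) :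
    LowerOnConstrainedT L M (deltaPol M n + P) (gamma2153 d L / 2) := by
  have hd1 : 1 ≤ d := by omega
  have hl : LowerOnConstrainedT L M (deltaPol M n) (gamma2153 d L) := lowerOnConstrainedT_of_represents M hd hL n hn hLM (represents_deltaPol M n)
  have h := lowerOnConstrainedT_add hl (form_abs_le_of_decay (one_le_M M) hPs hε hδP hP)
  have hle := eps_mul_le_half_gamma hd1 hL hδP hε hε₀
  intro B hQ hT
  have h1 := h B hQ hT
  have hB : 0 ≤ ∑ p, B p ^ 2 := Finset.sum_nonneg fun p _ => sq_nonneg _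
  nlinarith

/-- **(2.157) FOR THE PERTURBED MATRIX — INVERTIBILITY OF `C*(Δ_k + P)C`**, NO weight window: `⟨B′, C*(Δ_k+P)CB′⟩ ≥ (γ′₀∕2)‖CB′‖² ≥ (γ′₀∕2)‖B′‖²`
(`B6FromB4.sandwich_lowerBound`, `elimT_iso`, `isUnit_det_of_lower` — `T4Cov2156Rate.isUnit_sandwich_torus` verbatim at `Δ_k + P`).
[cite: Balaban1984PropagatorsII, (2.157) p.250 (shape)] [folklore] -/
theorem isUnit_sandwich_torus_add (hd : 2 ≤ d) (hL : 1 ≤ L) (hLM : ∀ i, L ∣ M i) {n : ℕ} (hn : 1 ≤ n)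
    {P : Matrix (B4.Idx (pbox M) d) (B4.Idx (pbox M) d) ℝ} (hPs : P.IsSymm) {ε δP : ℝ} (hε : 0 ≤ ε) (hδP : 0 < δP) (hε₀ : ε ≤ epsCov d L δP)
    (hP : ∀ p q : B4.Idx (pbox M) d, |P p q| ≤ ε * Real.exp (-(δP * pdist M (one_le_M M) (p.1 : Fin d → ℤ) (q.1 : Fin d → ℤ)))) :
    IsUnit ((elimT L M)ᵀ * (deltaPol M n + P) * elimT L M).det := by
  have hd1 : 1 ≤ d := by omega
  have hγ : 0 < gamma2153 d L / 2 := half_pos (gamma2153_pos hd1 hL)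
  have hl := lowerOnConstrainedT_deltaPol_add hd hL hLM hn hPs hε hδP hε₀ hP
  have hL0 : 0 < L := hL
  exact isUnit_det_of_lower hγ (B6FromB4.sandwich_lowerBound (elimT L M) (deltaPol M n + P) hγ.le
    (fun w => hl _ (fun c hc => q1_elimT_mulVec hL0 hLM w hc) (fun p hp => elimT_mulVec_tree w hp)) (fun w => elimT_iso w))

end Positivity

/-! ## §2 The decay of the perturbed covariance, uniform in the torus, the level and the perturbation -/

section Decay

variable (d) in
/-- ★ **THE DECAY OF `C(C*(Δ_k + P)C)⁻¹C*`, UNIFORM.**  Let `d ≥ 2`, `L ≥ 1`, `δ_P > 0`.  There are `c, δ > 0` (depending on `d, L, δ_P` only) such that for EVERY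
unit torus (`L ∣ M_i`), EVERY level `n ≥ 1` and EVERY symmetric `P` with `|P(b,b′)| ≤ ε·e^{−δ_Pρ_M(b₋,b′₋)}`, `0 ≤ ε ≤ ε₀(d,L,δ_P)`:
`|C(C*(Δ_k + P)C)⁻¹C*(b,b′)| ≤ c·e^{−δρ_M(b₋,b′₋)}` (`Δ_k = deltaPol M n`, `C = elimT`).  Chain: entry decay of `Δ_k + P` with `(c₀ + ε₀, min(δ₀, δ_P))`
(`kernelDecay166`), (2.153) at `γ′₀∕2` (§1), the p.250 engine `bond250_torusT`. [cite: Balaban1984PropagatorsII, (2.152)–(2.157) pp.249–250 (object, engine)] [folklore] -/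
theorem cov2156_decay_torus_add (hd : 2 ≤ d) (hL : 1 ≤ L) {δP : ℝ} (hδP : 0 < δP) :
    ∃ c δ : ℝ, 0 < c ∧ 0 < δ ∧
      ∀ (M : Fin d → ℕ) [∀ μ, NeZero (M μ)], (∀ i, L ∣ M i) → ∀ n : ℕ, 1 ≤ n →
        ∀ P : Matrix (B4.Idx (pbox M) d) (B4.Idx (pbox M) d) ℝ, P.IsSymm → ∀ ε : ℝ, 0 ≤ ε → ε ≤ epsCov d L δP →
        (∀ p q : B4.Idx (pbox M) d, |P p q| ≤ ε * Real.exp (-(δP * pdist M (one_le_M M) (p.1 : Fin d → ℤ) (q.1 : Fin d → ℤ)))) →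
        ∀ p q : B4.Idx (pbox M) d, |(bondReductionT L M (deltaPol M n + P)).cov p q| ≤
          c * Real.exp (-(δ * pdist M (one_le_M M) (p.1 : Fin d → ℤ) (q.1 : Fin d → ℤ))) := by
  have hd1 : 1 ≤ d := by omega
  obtain ⟨c₀, δ₀, hc₀, hδ₀, hK⟩ := kernelDecay166 (d := d) hd1
  have hγ : 0 < gamma2153 d L / 2 := half_pos (gamma2153_pos hd1 hL)
  have hε₀ := epsCov_pos hd1 hL hδP
  have hL0 : 0 < L := hL
  obtain ⟨c, δ, hc, hδ, H⟩ := bond250_torusT (d := d) (L := L) hL0 hγ (c₀ := c₀ + epsCov d L δP) (δ₀ := min δ₀ δP) (by positivity) (lt_min hδ₀ hδP)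
  refine ⟨c, δ, hc, hδ, fun M _ hLM n hn P hPs ε hε hεe hP p q => ?_⟩
  refine H M hLM (deltaPol M n + P) ((deltaPol_isSymm M n).add hPs) (fun p' q' => ?_) (lowerOnConstrainedT_deltaPol_add hd hL hLM hn hPs hε hδP hεe hP) p q
  have hdn := bondDist_nonneg (one_le_M M) p' q'
  rw [Matrix.add_apply]
  calc |deltaPol M n p' q' + P p' q'| ≤ |deltaPol M n p' q'| + |P p' q'| := abs_add_le _ _
    _ ≤ c₀ * Real.exp (-(δ₀ * pdist M (one_le_M M) (p'.1 : Fin d → ℤ) (q'.1 : Fin d → ℤ)))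
          + ε * Real.exp (-(δP * pdist M (one_le_M M) (p'.1 : Fin d → ℤ) (q'.1 : Fin d → ℤ))) := add_le_add (hK M n hn p' q') (hP p' q')
    _ ≤ c₀ * Real.exp (-(min δ₀ δP * pdist M (one_le_M M) (p'.1 : Fin d → ℤ) (q'.1 : Fin d → ℤ)))
          + epsCov d L δP * Real.exp (-(min δ₀ δP * pdist M (one_le_M M) (p'.1 : Fin d → ℤ) (q'.1 : Fin d → ℤ))) := by
        refine add_le_add (exp_decay_mono hc₀.le (min_le_left _ _) hdn) ?_
        exact (exp_decay_mono hε (min_le_right _ _) hdn).trans (mul_le_mul_of_nonneg_right hεe (Real.exp_nonneg _))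
    _ = (c₀ + epsCov d L δP) * Real.exp (-(min δ₀ δP * pdist M (one_le_M M) (p'.1 : Fin d → ℤ) (q'.1 : Fin d → ℤ))) := by ring

end Decay

/-! ## §3 The η-rate of the perturbed covariance: King's (4.39)–(4.41) with the middle factor `Δ^{(n₂)} − Δ^{(n₁)} + (P₂ − P₁)` -/

section Rate

variable (d) in
/-- ★★ **THE η-RATE OF THE PERTURBED (2.156) COVARIANCE.**  Let `d ≥ 2`, `L ≥ 1`, `δ_P > 0`.  There are `C′, δ′ > 0` (depending on `d, L, δ_P` only) such that
for EVERY unit torus (`L ∣ M_i`), ALL levels `n₁ ≥ 1`, `n₂ = R·n₁` (`R ≥ 1`), ALL symmetric `P₁, P₂` with `|P_i(b,b′)| ≤ ε·e^{−δ_Pρ}` (`0 ≤ ε ≤ ε₀(d,L,δ_P)`) and any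
difference letter `|P₂(b,b′) − P₁(b,b′)| ≤ τ·e^{−δ_Pρ}` (`τ ≥ 0`), and ALL bonds `b, b′`:
`|C(C*(Δ^{(n₂)}+P₂)C)⁻¹C*(b,b′) − C(C*(Δ^{(n₁)}+P₁)C)⁻¹C*(b,b′)| ≤ C′·(n₁⁻¹ + τ)·e^{−δ′ρ_M(b₋,b′₋)}`.
Chain = `T4Cov2156Rate.cov2156_rate_torus` VERBATIM with the middle factor `(Δ^{(n₂)} − Δ^{(n₁)}) + (P₂ − P₁)` (`kernelRate166` + the `τ`-letter), both endpoint
decays from §2, invertibility from §1, `redCov_rate` (King (4.40)–(4.41)). [cite: King1986, Lemma 4.5 (4.38)–(4.41) pp.674–675 (shape, mechanism); Balaban1984PropagatorsII, (2.156) p.250 (object)] [folklore] -/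
theorem cov2156_rate_torus_add (hd : 2 ≤ d) (hL : 1 ≤ L) {δP : ℝ} (hδP : 0 < δP) :
    ∃ C' δ' : ℝ, 0 < C' ∧ 0 < δ' ∧
      ∀ (M : Fin d → ℕ) [∀ μ, NeZero (M μ)], (∀ i, L ∣ M i) →
        ∀ n₁ n₂ R : ℕ, 1 ≤ n₁ → 1 ≤ R → n₂ = R * n₁ →
        ∀ P₁ P₂ : Matrix (B4.Idx (pbox M) d) (B4.Idx (pbox M) d) ℝ, P₁.IsSymm → P₂.IsSymm →
        ∀ ε τ : ℝ, 0 ≤ ε → ε ≤ epsCov d L δP → 0 ≤ τ →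
        (∀ p q : B4.Idx (pbox M) d, |P₁ p q| ≤ ε * Real.exp (-(δP * pdist M (one_le_M M) (p.1 : Fin d → ℤ) (q.1 : Fin d → ℤ)))) →
        (∀ p q : B4.Idx (pbox M) d, |P₂ p q| ≤ ε * Real.exp (-(δP * pdist M (one_le_M M) (p.1 : Fin d → ℤ) (q.1 : Fin d → ℤ)))) →
        (∀ p q : B4.Idx (pbox M) d, |P₂ p q - P₁ p q| ≤ τ * Real.exp (-(δP * pdist M (one_le_M M) (p.1 : Fin d → ℤ) (q.1 : Fin d → ℤ)))) →
        ∀ p q : B4.Idx (pbox M) d,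
          |(bondReductionT L M (deltaPol M n₂ + P₂)).cov p q - (bondReductionT L M (deltaPol M n₁ + P₁)).cov p q|
            ≤ C' * ((n₁ : ℝ)⁻¹ + τ) *
                Real.exp (-(δ' * pdist M (one_le_M M) (p.1 : Fin d → ℤ) (q.1 : Fin d → ℤ))) := by
  have hd1 : 1 ≤ d := by omega
  obtain ⟨θ₀, δ₁, hθ₀, hδ₁, hR⟩ := kernelRate166 (d := d) hd1
  obtain ⟨c, δ, hc, hδ, hD⟩ := cov2156_decay_torus_add d hd hL hδP
  set κ := min (min δ δ₁) δP with hκdef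
  have hκ : 0 < κ := lt_min (lt_min hδ hδ₁) hδP
  have hκδ : κ ≤ δ := (min_le_left _ _).trans (min_le_left _ _)
  have hκδ₁ : κ ≤ δ₁ := (min_le_left _ _).trans (min_le_right _ _)
  have hκP : κ ≤ δP := min_le_right _ _
  set V := (d : ℝ) * latticeConst d (κ / 2) with hV
  refine ⟨c * (θ₀ + 1) * c * V ^ 2 + 1, κ / 2, by positivity, by positivity, ?_⟩
  intro M _ hLM n₁ n₂ R' hn₁ hR1 h P₁ P₂ hP₁s hP₂s ε τ hε hεe hτ hP₁ hP₂ hP21 p q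
  have hn₂ : 1 ≤ n₂ := by subst h; exact Nat.one_le_iff_ne_zero.mpr (Nat.mul_ne_zero (by omega) (by omega))
  set dist : B4.Idx (pbox M) d → B4.Idx (pbox M) d → ℝ :=
    fun p q => pdist M (one_le_M M) (p.1 : Fin d → ℤ) (q.1 : Fin d → ℤ) with hdist
  have hd0 : ∀ i j, 0 ≤ dist i j := bondDist_nonneg (one_le_M M)
  have htri : ∀ i j k, dist i k ≤ dist i j + dist j k := bondDist_triangle (one_le_M M)
  have hC : ∀ (n : ℕ) (P : Matrix (B4.Idx (pbox M) d) (B4.Idx (pbox M) d) ℝ), 1 ≤ n → P.IsSymm →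
      (∀ p q : B4.Idx (pbox M) d, |P p q| ≤ ε * Real.exp (-(δP * pdist M (one_le_M M) (p.1 : Fin d → ℤ) (q.1 : Fin d → ℤ)))) →
      ∀ x y, |redCov (elimT L M) (deltaPol M n + P) x y| ≤ c * Real.exp (-(κ * dist x y)) := by
    intro n P hn hPs hP x y
    have h0 := hD M hLM n hn P hPs ε hε hεe hP x y
    rw [subReduction_cov_eq] at h0
    exact h0.trans (exp_decay_mono hc.le hκδ (hd0 x y))
  -- the middle factor: (Δ₂ + P₂) − (Δ₁ + P₁) = (Δ₂ − Δ₁) + (P₂ − P₁)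
  have hθn : 0 ≤ θ₀ * (n₁ : ℝ)⁻¹ + τ := add_nonneg (mul_nonneg hθ₀.le (inv_nonneg.mpr (Nat.cast_nonneg _))) hτ
  have hE : ∀ z w, |(deltaPol M n₂ + P₂ - (deltaPol M n₁ + P₁)) z w| ≤ (θ₀ * (n₁ : ℝ)⁻¹ + τ) * Real.exp (-(κ * dist z w)) := by
    intro z w
    have e : (deltaPol M n₂ + P₂ - (deltaPol M n₁ + P₁)) z w = (deltaPol M n₂ z w - deltaPol M n₁ z w) + (P₂ z w - P₁ z w) := by
      simp only [Matrix.sub_apply, Matrix.add_apply]; ring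
    rw [e]
    have h1 := (hR M n₁ n₂ R' hn₁ hR1 h z w).trans
      (exp_decay_mono (mul_nonneg hθ₀.le (inv_nonneg.mpr (Nat.cast_nonneg _))) hκδ₁ (hd0 z w))
    have h2 := (hP21 z w).trans (exp_decay_mono hτ hκP (hd0 z w))
    calc |deltaPol M n₂ z w - deltaPol M n₁ z w + (P₂ z w - P₁ z w)|
        ≤ |deltaPol M n₂ z w - deltaPol M n₁ z w| + |P₂ z w - P₁ z w| := abs_add_le _ _
      _ ≤ θ₀ * (n₁ : ℝ)⁻¹ * Real.exp (-(κ * dist z w)) + τ * Real.exp (-(κ * dist z w)) := add_le_add h1 h2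
      _ = (θ₀ * (n₁ : ℝ)⁻¹ + τ) * Real.exp (-(κ * dist z w)) := by ring
  have hVb : ∀ x, ∑ z, Real.exp (-(κ / 2 * dist x z)) ≤ V := fun x => bondSum_le (one_le_M M) (half_pos hκ) x
  have main := redCov_rate dist hd0 htri (elimT L M) (deltaPol M n₁ + P₁) (deltaPol M n₂ + P₂)
    (isUnit_sandwich_torus_add hd hL hLM hn₁ hP₁s hε hδP hεe hP₁) (isUnit_sandwich_torus_add hd hL hLM hn₂ hP₂s hε hδP hεe hP₂)
    hκ.le hc.le hθn (hC n₁ P₁ hn₁ hP₁s hP₁) (hC n₂ P₂ hn₂ hP₂s hP₂) hE hVb p q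
  rw [subReduction_cov_eq, subReduction_cov_eq]
  show |redCov (elimT L M) (deltaPol M n₂ + P₂) p q - redCov (elimT L M) (deltaPol M n₁ + P₁) p q| ≤ _
  rw [abs_sub_comm]
  refine main.trans ?_
  have hEx := Real.exp_nonneg (-(κ / 2 * dist p q))
  have hn0 : 0 ≤ (n₁ : ℝ)⁻¹ := inv_nonneg.mpr (Nat.cast_nonneg _)
  have hn1 : (n₁ : ℝ)⁻¹ ≤ 1 := by
    have : (1 : ℝ) ≤ n₁ := by exact_mod_cast hn₁
    exact inv_le_one_of_one_le₀ this
  have hV0 : 0 ≤ V ^ 2 := sq_nonneg _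
  -- θ₀ n₁⁻¹ + τ ≤ (θ₀ + 1)(n₁⁻¹ + τ)
  have hmid : θ₀ * (n₁ : ℝ)⁻¹ + τ ≤ (θ₀ + 1) * ((n₁ : ℝ)⁻¹ + τ) := by nlinarith
  calc c * (θ₀ * (n₁ : ℝ)⁻¹ + τ) * c * V ^ 2 * Real.exp (-(κ / 2 * dist p q))
      ≤ c * ((θ₀ + 1) * ((n₁ : ℝ)⁻¹ + τ)) * c * V ^ 2 * Real.exp (-(κ / 2 * dist p q)) := by gcongr
    _ = (c * (θ₀ + 1) * c * V ^ 2) * ((n₁ : ℝ)⁻¹ + τ) * Real.exp (-(κ / 2 * dist p q)) := by ring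
    _ ≤ (c * (θ₀ + 1) * c * V ^ 2 + 1) * ((n₁ : ℝ)⁻¹ + τ) * Real.exp (-(κ / 2 * dist p q)) :=
        mul_le_mul_of_nonneg_right (mul_le_mul_of_nonneg_right (by linarith) (add_nonneg hn0 hτ)) hEx

variable (d) in
/-- ★★ **KING'S (4.38) SHAPE FOR THE PERTURBED COVARIANCE**: with `n₁ = L^k`, `n₂ = L^{k+m}`: `|C^{(k+m)}_{P₂}(b,b′) − C^{(k)}_{P₁}(b,b′)| ≤
C′·((L^k)⁻¹ + τ)·e^{−δ′ρ_M(b₋,b′₋)}`, uniformly in `k, m`, the torus and the admissible perturbations. [cite: King1986, Lemma 4.5 (4.38) p.674 (shape); Balaban1984PropagatorsII, (2.156) p.250 (object)] [folklore] -/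
theorem cov2156_rate_torus_add_king (hd : 2 ≤ d) (hL : 1 ≤ L) {δP : ℝ} (hδP : 0 < δP) :
    ∃ C' δ' : ℝ, 0 < C' ∧ 0 < δ' ∧
      ∀ (M : Fin d → ℕ) [∀ μ, NeZero (M μ)], (∀ i, L ∣ M i) → ∀ k m : ℕ,
        ∀ P₁ P₂ : Matrix (B4.Idx (pbox M) d) (B4.Idx (pbox M) d) ℝ, P₁.IsSymm → P₂.IsSymm →
        ∀ ε τ : ℝ, 0 ≤ ε → ε ≤ epsCov d L δP → 0 ≤ τ →
        (∀ p q : B4.Idx (pbox M) d, |P₁ p q| ≤ ε * Real.exp (-(δP * pdist M (one_le_M M) (p.1 : Fin d → ℤ) (q.1 : Fin d → ℤ)))) →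
        (∀ p q : B4.Idx (pbox M) d, |P₂ p q| ≤ ε * Real.exp (-(δP * pdist M (one_le_M M) (p.1 : Fin d → ℤ) (q.1 : Fin d → ℤ)))) →
        (∀ p q : B4.Idx (pbox M) d, |P₂ p q - P₁ p q| ≤ τ * Real.exp (-(δP * pdist M (one_le_M M) (p.1 : Fin d → ℤ) (q.1 : Fin d → ℤ)))) →
        ∀ p q : B4.Idx (pbox M) d,
          |(bondReductionT L M (deltaPol M (L ^ (k + m)) + P₂)).cov p q - (bondReductionT L M (deltaPol M (L ^ k) + P₁)).cov p q|
            ≤ C' * (((L : ℝ) ^ k)⁻¹ + τ) *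
                Real.exp (-(δ' * pdist M (one_le_M M) (p.1 : Fin d → ℤ) (q.1 : Fin d → ℤ))) := by
  obtain ⟨C', δ', hC', hδ', H⟩ := cov2156_rate_torus_add d hd hL hδP
  refine ⟨C', δ', hC', hδ', fun M _ hLM k m P₁ P₂ h1 h2 ε τ hε hεe hτ hP₁ hP₂ hP21 p q => ?_⟩
  have hLk : 1 ≤ L ^ k := Nat.one_le_pow _ _ hL
  have hLm : 1 ≤ L ^ m := Nat.one_le_pow _ _ hL
  have h := H M hLM (L ^ k) (L ^ (k + m)) (L ^ m) hLk hLm (by rw [pow_add, mul_comm]) P₁ P₂ h1 h2 ε τ hε hεe hτ hP₁ hP₂ hP21 p q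
  simpa using h

variable (d) in
/-- CONSISTENCY: at `P₁ = P₂ = 0` the perturbed rate is the unperturbed King shape of `T4Cov2156Rate.cov2156_rate_torus_king` (with this file's constants): the
zero perturbation is admissible (`ε = τ = 0`). [folklore] -/
theorem cov2156_rate_torus_add_zero (hd : 2 ≤ d) (hL : 1 ≤ L) :
    ∃ C' δ' : ℝ, 0 < C' ∧ 0 < δ' ∧
      ∀ (M : Fin d → ℕ) [∀ μ, NeZero (M μ)], (∀ i, L ∣ M i) → ∀ k m : ℕ, ∀ p q : B4.Idx (pbox M) d,
        |(bondReductionT L M (deltaPol M (L ^ (k + m)))).cov p q - (bondReductionT L M (deltaPol M (L ^ k))).cov p q|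
          ≤ C' * ((L : ℝ) ^ k)⁻¹ *
              Real.exp (-(δ' * pdist M (one_le_M M) (p.1 : Fin d → ℤ) (q.1 : Fin d → ℤ))) := by
  obtain ⟨C', δ', hC', hδ', H⟩ := cov2156_rate_torus_add_king d hd hL zero_lt_one
  refine ⟨C', δ', hC', hδ', fun M _ hLM k m p q => ?_⟩
  have hd1 : 1 ≤ d := by omega
  have h0 : ∀ p q : B4.Idx (pbox M) d, |(0 : Matrix (B4.Idx (pbox M) d) (B4.Idx (pbox M) d) ℝ) p q|
      ≤ 0 * Real.exp (-(1 * pdist M (one_le_M M) (p.1 : Fin d → ℤ) (q.1 : Fin d → ℤ))) := fun p q => by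
    rw [Matrix.zero_apply, abs_zero, zero_mul]
  have h00 : ∀ p q : B4.Idx (pbox M) d, |(0 : Matrix (B4.Idx (pbox M) d) (B4.Idx (pbox M) d) ℝ) p q - (0 : Matrix _ _ ℝ) p q|
      ≤ 0 * Real.exp (-(1 * pdist M (one_le_M M) (p.1 : Fin d → ℤ) (q.1 : Fin d → ℤ))) := fun p q => by
    rw [Matrix.zero_apply, sub_zero, abs_zero, zero_mul]
  have h := H M hLM k m 0 0 Matrix.isSymm_zero Matrix.isSymm_zero 0 0 le_rfl (epsCov_pos hd1 hL zero_lt_one).le le_rfl h0 h0 h00 p q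
  have e1 : deltaPol M (L ^ (k + m)) + (0 : Matrix (B4.Idx (pbox M) d) (B4.Idx (pbox M) d) ℝ) = deltaPol M (L ^ (k + m)) := add_zero _
  have e2 : deltaPol M (L ^ k) + (0 : Matrix (B4.Idx (pbox M) d) (B4.Idx (pbox M) d) ℝ) = deltaPol M (L ^ k) := add_zero _
  have e3 : ((L : ℝ) ^ k)⁻¹ + 0 = ((L : ℝ) ^ k)⁻¹ := add_zero _
  rw [e1, e2, e3] at h
  exact h

end Rate

end Summit.QuantumFields.YangMills.BalabanUVNodes.N15.UnitLayerBg

end
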